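import Summits.Schanuel.Schanuel.Theorems.DiophantineDichotomyApproximationPropertyZeroDimDictionary
import HarnessLib

/-!
# Galois orbits meet a `ℚ`-closed set entirely or not at all (helper for crux `ApproximationProperty`, stmt-Schanuel-6117)

Route `DiophantineDichotomy` (sub-problem `Schanuel/Schanuel`), line `orbit-interpolation-determinant`,
lead c2 (`prover-line-stmt-Schanuel-6117-c2-0`, 2026-08-16). Structure lemma for the case analysis of
the interpolation clause at `t = 3` (lead NOTES §Clause): the output of the clause-free descent is a
0-dimensional homogeneous prime `𝔭 ⊂ ℚ[x₀, …, x_m]` (`IsUnmixedOfRank 𝔭 1`), whose projective zeros form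
ONE Galois orbit (the 0-dimensional dictionary `ZeroDimDictionary`, landed: the zeros are the non-zero
multiples of the conjugates `σ ∘ b` of one point `b` over a number field `K`). Consequently, for every ideal
`J ⊂ ℚ[x₀, …, x_m]` stable under taking homogeneous components (e.g. the ideal of the 1-dimensional part of
`V(Q₁, P₂, P₃)`, or a second component `𝔮` of the curve section), the orbit `V(𝔭)` is either DISJOINT from
`V(J)` or CONTAINED in it (`orbit_subset_projZeros_of_meets`, registered helper sub-goal): if one conjugate
`l · σ(b)` is a zero of the rational forms of `J`, then so is `b` (apply `σ⁻¹` on `σ(K)`: a ring map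
`K →+* ℂ` is injective and commutes with the evaluation of a polynomial with rational coefficients,
`MvPolynomial.map_aeval` + uniqueness of `ℚ →+* ℂ`), hence so is every `l' · τ(b)`.

No new definitions; no named fact; everything used is landed (`stub_zeroDimDictionary`,
`PhilipponMain.smul_mem_projZeros`, `Nesterenko.aeval_smul_of_isHomogeneous`).
-/

noncomputable section

-- `Summit.Schanuel.Schanuel.…` is the mandated summit/sub-problem namespace (single-conjunct summit), hence:
set_option linter.dupNamespace false

attribute [local instance] MvPolynomial.gradedAlgebra

namespace Summit.Schanuel.Schanuel.Cruxes.ApproximationProperty.OrbitInterpolationDeterminant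

open Literature.NumberTheory.Transcendental.Nesterenko MvPolynomial
open scoped BigOperators

/-- Evaluation of a rational polynomial commutes with a ring map out of a field of characteristic zero:
`σ (P(b)) = P(σ ∘ b)`. [folklore] -/
theorem ringHom_aeval_eq {m : ℕ} {K : Type} [Field K] [CharZero K] (σ : K →+* ℂ)
    (b : Fin (m + 1) → K) (P : Rx m) :
    σ (aeval b P) = aeval (fun j => σ (b j)) P := by
  have hq : σ.comp (algebraMap ℚ K) = algebraMap ℚ ℂ := Subsingleton.elim _ _
  rw [map_aeval, hq, aeval_def, coe_eval₂Hom]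

/-- If a conjugate `σ ∘ b` of a `K`-point is a common zero of an ideal `J` of RATIONAL polynomials that
is stable under homogeneous components, then every rescaled conjugate `l · (τ ∘ b)` is. [folklore] -/
theorem aeval_conj_eq_zero_of_aeval_conj_eq_zero {m : ℕ} {K : Type} [Field K] [CharZero K]
    (σ τ : K →+* ℂ) (b : Fin (m + 1) → K) {J : Ideal (Rx m)}
    (hJ : ∀ P ∈ J, ∀ k : ℕ, homogeneousComponent k P ∈ J)
    (hσ : ∀ P ∈ J, aeval (fun j => σ (b j)) P = 0) (l : ℂ) :
    ∀ P ∈ J, aeval (fun j => l * τ (b j)) P = 0 := by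
  intro P hP
  classical
  conv_lhs => rw [← sum_homogeneousComponent P]
  rw [map_sum]
  refine Finset.sum_eq_zero fun k _ => ?_
  have hk : aeval b (homogeneousComponent k P) = 0 := by
    have h1 := hσ _ (hJ P hP k)
    rw [← ringHom_aeval_eq] at h1
    exact (map_eq_zero σ).mp h1
  have hτ : aeval (fun j => τ (b j)) (homogeneousComponent k P) = 0 := by
    rw [← ringHom_aeval_eq, hk, map_zero]
  have e : (fun j => l * τ (b j)) = l • (fun j => τ (b j)) := by
    ext j; simp [Pi.smul_apply, smul_eq_mul]
  rw [e, aeval_smul_of_isHomogeneous _ (homogeneousComponent_isHomogeneous k P), hτ, mul_zero]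

/-- **Orbit dichotomy** (registered helper sub-goal `orbit_subset_projZeros_of_meets`). Let
`𝔭 ⊂ ℚ[x₀, …, x_m]` (`m ≥ 1`) be a homogeneous prime with `IsUnmixedOfRank 𝔭 1` (a 0-dimensional prime: a
Galois orbit of points of `ℙ^m`) and `J` an ideal stable under homogeneous components. If ONE projective
zero of `𝔭` is a zero of `J`, then EVERY projective zero of `𝔭` is: `V(𝔭) ∩ V(J) ≠ ∅ ⟹ V(𝔭) ⊆ V(J)`.
[folklore] -/
theorem orbit_subset_projZeros_of_meets : ∀ (m : ℕ) (𝔭 J : Ideal (Rx m)), 1 ≤ m → 𝔭.IsPrime →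
    𝔭.IsHomogeneous (homogeneousSubmodule (Fin (m + 1)) ℚ) → IsUnmixedOfRank 𝔭 1 →
    (∀ P ∈ J, ∀ k : ℕ, homogeneousComponent k P ∈ J) →
    (∃ β ∈ projZeros 𝔭, β ∈ projZeros J) → projZeros 𝔭 ⊆ projZeros J := by
  intro m 𝔭 J hm h𝔭 hhom hunm hJ hmeet
  obtain ⟨β₀, hβ₀𝔭, hβ₀J⟩ := hmeet
  obtain ⟨c, -, hdict⟩ := stub_zeroDimDictionary m hm
  obtain ⟨K, _, _, b, -, hzeros, -⟩ := hdict 𝔭 h𝔭 hhom hunm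
  -- the meeting zero is `l₀ · σ₀(b)` with `l₀ ≠ 0`
  obtain ⟨hβ₀0, σ₀, l₀, hβ₀eq⟩ := (hzeros β₀).mp hβ₀𝔭
  have hl₀ : l₀ ≠ 0 := by
    rintro rfl
    exact hβ₀0 (by rw [hβ₀eq]; ext j; simp)
  -- hence `σ₀ ∘ b` itself is a zero of `J` (cone property of `V(J)`)
  have hσ₀ : ∀ P ∈ J, aeval (fun j => σ₀ (b j)) P = 0 := by
    have hcone := Literature.NumberTheory.Transcendental.PhilipponMain.smul_mem_projZeros hJ hβ₀J
      (inv_ne_zero hl₀)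
    have e : l₀⁻¹ • β₀ = fun j => σ₀ (b j) := by
      rw [hβ₀eq]; ext j; simp [Pi.smul_apply, smul_eq_mul, ← mul_assoc, inv_mul_cancel₀ hl₀]
    rw [e] at hcone
    exact hcone.2
  -- every zero of `𝔭` is `l · τ(b)`, hence a zero of `J`
  intro β hβ
  obtain ⟨hβ0, τ, l, rfl⟩ := (hzeros β).mp hβ
  exact ⟨hβ0, aeval_conj_eq_zero_of_aeval_conj_eq_zero σ₀ τ b hJ hσ₀ l⟩

end Summit.Schanuel.Schanuel.Cruxes.ApproximationProperty.OrbitInterpolationDeterminant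

end
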